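import Mathlib
import Summits.NavierStokesRegularity.NavierStokesRegularity.Theorems.FilamentSkeletonRssClause13PointwiseChainVar

/-!
# Clause 13-J/13-R, brick m3b-Z (THE TWO-ZONE POINTWISE CHAIN, VARIABLE COEFFICIENTS): waist → damped zone → amplified zone, both sides

Route `FilamentSkeletonRss`, ∃-side clause 13 (`Clause13RNearStraightL`, stmt-NavierStokesRegularity-23612; typing-agnostic).  Design of record
rev 80–82 (NOT DECOMPOSED YET, m3b = director default (ii) with tenure note R-m3b-2): near the waist the far piece of a variation obeys the
regular–singular transport ODE `w(τ)·z′ = iG·z + α(τ)·z + β(τ)·z̄ + f`, `w(c) = 0`, and "outward integration gives `|z(τ)| ≤ C·sup|f|·(1+|τ−c|)^{b_*}`,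
linear in the defect, `Γ`-free, at the price `b ≥ b_*`".  In the skeleton class `½w′ + Re β₁ ≡ ¾` (trace identity), so `Re α = ¾ − ½w′` is
NEGATIVE at the waist (`w′(c) = 3/2 + δ` ⇒ `Re α(c) = −δ/2`: DAMPED zone) and POSITIVE far out (`w′ → ½` ⇒ `Re α → ½`: AMPLIFIED zone) — hence two
zones with variable coefficients.  The single-zone fences are landed (`waist_norm_le_of_damped_var`, `farBranch_norm_le_weighted_var`, p714527,
`…Clause13PointwiseChainVar`); this file is the COMPOSITION (lane g17 successor step (2)):
* §1 ★ `twoZone_norm_le_var` — on `[c, b]` with `w` continuous, `w(c) = 0`, `w > 0` on `(c, b]`, `‖f‖ ≤ M`, `‖β‖ ≤ β_max ≤ G`, `k = β_max/(2G)`,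
  a split point `c < d ≤ b`, the damping margin on `[c, d]` + the waist inequality, and on `[d, b]` `w ≥ w₁(τ−c)` with the growth booked in the
  exponent `p ≥ 0`:  `‖z‖ ≤ K·M` on `[c, d]` and `‖z(τ)‖ ≤ ((τ−c)/(d−c))^p·K·(β₀K·M)` on `[d, b]`, `K = ((1+k)/β₀)/(1−k)`
  (the damped-zone output `K·M = (β₀K·M)/β₀` re-enters the amplified zone as the initial bound for the forcing level `β₀K·M ≥ M`);
* §2 ★ `twoZone_norm_le_var_left` — the mirror statement on `[b, c]` (`w < 0` on `[b, c)`, zones `[e, c]` and `[b, e]`, variation terms with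
  `−w`), by the reflection `τ ↦ 2c − τ`.
Lane ns-filament-19175-p1 g18; `--supports stmt-NavierStokesRegularity-23612 --as helper`.
HONEST FRAMING: ODE lemmas for the bookkeeping of a HYPOTHETICAL filament skeleton on the NEGATIVE side of a MODEL route; nothing here bears on
Navier–Stokes regularity or blow-up; 23610/23612 stay OPEN.
-/

noncomputable section

open scoped InnerProductSpace ComplexConjugate
open Set Complex MeasureTheory Filter Topology

namespace Summit.NavierStokesRegularity.NavierStokesRegularity.Theorems.Clause13Transport
set_option linter.dupNamespace false

/-! ## §1 The two zones at once (right side of the waist) -/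

/-- ★ **THE TWO-ZONE POINTWISE CHAIN (right side of the waist, variable coefficients).**  `w·z′ = iG z + α(τ)z + β(τ)z̄ + f` on `[c, b]`
(`z, β ∈ C¹`), `w` continuous, `w(c) = 0`, `w > 0` on `(c, b]`, `‖f‖ ≤ M`, `‖β‖ ≤ β_max ≤ G`, `k = β_max/(2G)`; a split point `c < d ≤ b` with
— on `[c, d]`: the damping margin of `waist_norm_le_of_damped_var` and `β₀ ≤ G − ‖α(c)‖ − ‖β(c)‖`;
— on `[d, b]`: `w(τ) ≥ w₁(τ−c)` and the growth condition of `farBranch_norm_le_weighted_var` with exponent `p ≥ 0`.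
Then with `K = ((1+k)/β₀)/(1−k)`:  `‖z(τ)‖ ≤ K·M` on `[c, d]`, and `‖z(τ)‖ ≤ ((τ−c)/(d−c))^p·K·(β₀K·M)` on `[d, b]` — linear in `M`,
`G` enters only through `k ≤ ½` and the waist inequality. [folklore] -/
theorem twoZone_norm_le_var {z z' f α β β' : ℝ → ℂ} {w : ℝ → ℝ} {c d b G M β₀ βmax w₁ p : ℝ}
    (hG : 0 < G) (hM : 0 ≤ M) (hβ₀ : 0 < β₀) (hβmax0 : 0 ≤ βmax) (hcd : c < d) (hdb : d ≤ b) (hw₁ : 0 < w₁) (hp0 : 0 ≤ p)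
    (hz : ∀ τ ∈ Icc c b, HasDerivAt z (z' τ) τ) (hβ : ∀ τ ∈ Icc c b, HasDerivAt β (β' τ) τ)
    (hwcont : Continuous w) (hwc : w c = 0) (hw : ∀ τ ∈ Ioc c b, 0 < w τ) (hw1 : ∀ τ ∈ Icc d b, w₁ * (τ - c) ≤ w τ)
    (hode : ∀ τ ∈ Icc c b, (w τ : ℂ) * z' τ = I * G * z τ + α τ * z τ + β τ * conj (z τ) + f τ)
    (hf : ∀ τ ∈ Icc c b, ‖f τ‖ ≤ M) (hβmax : ∀ τ ∈ Icc c b, ‖β τ‖ ≤ βmax) (hsmall : βmax ≤ G)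
    (hgain : ∀ τ ∈ Icc c d, β₀ ≤ -(α τ).re
      - (βmax / (2 * G)) / (1 - βmax / (2 * G)) * (2 * |(α τ).im| + βmax / (2 * G) * ‖β τ‖)
      - (w τ * ‖β' τ‖ / (2 * G)) / (1 - βmax / (2 * G)))
    (hstag : β₀ ≤ G - ‖α c‖ - ‖β c‖)
    (hgrow : ∀ τ ∈ Icc d b, (α τ).re + β₀
      + (βmax / (2 * G)) / (1 - βmax / (2 * G)) * (2 * |(α τ).im| + βmax / (2 * G) * ‖β τ‖)
      + (w τ * ‖β' τ‖ / (2 * G)) / (1 - βmax / (2 * G)) ≤ p * w₁) :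
    (∀ τ ∈ Icc c d, ‖z τ‖ ≤ ((1 + βmax / (2 * G)) / β₀) / (1 - βmax / (2 * G)) * M) ∧
    (∀ τ ∈ Icc d b, ‖z τ‖ ≤ ((τ - c) / (d - c)) ^ p *
        ((((1 + βmax / (2 * G)) / β₀) / (1 - βmax / (2 * G))) *
          ((β₀ * (((1 + βmax / (2 * G)) / β₀) / (1 - βmax / (2 * G)))) * M))) := by
  have hk1 : βmax / (2 * G) ≤ 1 / 2 := by rw [div_le_iff₀ (by positivity)]; linarith
  have h1k : 0 < 1 - βmax / (2 * G) := by linarith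
  set K : ℝ := ((1 + βmax / (2 * G)) / β₀) / (1 - βmax / (2 * G)) with hKdef
  have hK0 : 0 < K := by positivity
  -- damped zone
  have hsub1 : Icc c d ⊆ Icc c b := Icc_subset_Icc le_rfl hdb
  have hdz := waist_norm_le_of_damped_var (b := d) hG hM hβ₀ hβmax0 (fun t ht => hz t (hsub1 ht)) (fun t ht => hβ t (hsub1 ht)) hwcont hwc
    (fun t ht => hw t ⟨ht.1, ht.2.trans hdb⟩) (fun t ht => hode t (hsub1 ht)) (fun t ht => hf t (hsub1 ht))
    (fun t ht => hβmax t (hsub1 ht)) hsmall hgain hstag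
  have hdz' : ∀ τ ∈ Icc c d, ‖z τ‖ ≤ K * M := by
    intro τ hτ
    refine (hdz τ hτ).trans (le_of_eq ?_)
    simp only [hKdef]
    field_simp
  refine ⟨hdz', ?_⟩
  -- amplified zone, forcing level `M' = β₀ K M ≥ M`, initial bound `‖z d‖ ≤ K M = M'/β₀`
  have hβ₀K : 1 ≤ β₀ * K := by
    simp only [hKdef]
    rw [show β₀ * ((1 + βmax / (2 * G)) / β₀ / (1 - βmax / (2 * G))) = (1 + βmax / (2 * G)) / (1 - βmax / (2 * G)) by
      field_simp]
    rw [le_div_iff₀ h1k]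
    linarith [show 0 ≤ βmax / (2 * G) by positivity]
  have hM' : 0 ≤ β₀ * K * M := by positivity
  have hsub2 : Icc d b ⊆ Icc c b := Icc_subset_Icc hcd.le le_rfl
  have hf' : ∀ τ ∈ Icc d b, ‖f τ‖ ≤ β₀ * K * M := by
    intro τ hτ
    refine (hf τ (hsub2 hτ)).trans ?_
    have := mul_le_mul_of_nonneg_right hβ₀K hM
    linarith
  have hd' : ‖z d‖ ≤ β₀ * K * M / β₀ := by
    rw [show β₀ * K * M / β₀ = K * M by field_simp]
    exact hdz' d (right_mem_Icc.2 hcd.le)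
  have haz := farBranch_norm_le_weighted_var (a := d) (b := b) hG hM' hβ₀ hβmax0 hcd hw₁ hp0 (fun t ht => hz t (hsub2 ht)) (fun t ht => hβ t (hsub2 ht))
    hwcont hw1 (fun t ht => hode t (hsub2 ht)) hf' (fun t ht => hβmax t (hsub2 ht)) hsmall hgrow hd'
  intro τ hτ
  refine (haz τ hτ).trans (le_of_eq ?_)
  simp only [hKdef]
  field_simp

/-! ## §2 The left side of the waist (reflection `τ ↦ 2c − τ`) -/

/-- ★ **Left twin of `twoZone_norm_le_var`.**  On `[b, c]` with `w(c) = 0`, `w < 0` on `[b, c)` (the slip points INTO the stagnation point from both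
sides when `w′(c) > 0`): damped zone `[e, c]` (margin with the variation term `(−w)‖β′‖/(2G(1−k))`), amplified zone `[b, e]` with
`−w(τ) ≥ w₁(c−τ)` and the growth booked in the exponent `p`.  Then `‖z‖ ≤ K·M` on `[e, c]` and `‖z(τ)‖ ≤ ((c−τ)/(c−e))^p·K·(β₀K·M)` on `[b, e]`
(apply `twoZone_norm_le_var` to `s ↦ z(2c−s)`, under which `w̃(s) = −w(2c−s) > 0` and the ODE keeps its form). [folklore] -/
theorem twoZone_norm_le_var_left {z z' f α β β' : ℝ → ℂ} {w : ℝ → ℝ} {c e b G M β₀ βmax w₁ p : ℝ}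
    (hG : 0 < G) (hM : 0 ≤ M) (hβ₀ : 0 < β₀) (hβmax0 : 0 ≤ βmax) (hec : e < c) (hbe : b ≤ e) (hw₁ : 0 < w₁) (hp0 : 0 ≤ p)
    (hz : ∀ τ ∈ Icc b c, HasDerivAt z (z' τ) τ) (hβ : ∀ τ ∈ Icc b c, HasDerivAt β (β' τ) τ)
    (hwcont : Continuous w) (hwc : w c = 0) (hw : ∀ τ ∈ Ico b c, w τ < 0) (hw1 : ∀ τ ∈ Icc b e, w₁ * (c - τ) ≤ -w τ)
    (hode : ∀ τ ∈ Icc b c, (w τ : ℂ) * z' τ = I * G * z τ + α τ * z τ + β τ * conj (z τ) + f τ)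
    (hf : ∀ τ ∈ Icc b c, ‖f τ‖ ≤ M) (hβmax : ∀ τ ∈ Icc b c, ‖β τ‖ ≤ βmax) (hsmall : βmax ≤ G)
    (hgain : ∀ τ ∈ Icc e c, β₀ ≤ -(α τ).re
      - (βmax / (2 * G)) / (1 - βmax / (2 * G)) * (2 * |(α τ).im| + βmax / (2 * G) * ‖β τ‖)
      - (-w τ * ‖β' τ‖ / (2 * G)) / (1 - βmax / (2 * G)))
    (hstag : β₀ ≤ G - ‖α c‖ - ‖β c‖)
    (hgrow : ∀ τ ∈ Icc b e, (α τ).re + β₀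
      + (βmax / (2 * G)) / (1 - βmax / (2 * G)) * (2 * |(α τ).im| + βmax / (2 * G) * ‖β τ‖)
      + (-w τ * ‖β' τ‖ / (2 * G)) / (1 - βmax / (2 * G)) ≤ p * w₁) :
    (∀ τ ∈ Icc e c, ‖z τ‖ ≤ ((1 + βmax / (2 * G)) / β₀) / (1 - βmax / (2 * G)) * M) ∧
    (∀ τ ∈ Icc b e, ‖z τ‖ ≤ ((c - τ) / (c - e)) ^ p *
        ((((1 + βmax / (2 * G)) / β₀) / (1 - βmax / (2 * G))) *
          ((β₀ * (((1 + βmax / (2 * G)) / β₀) / (1 - βmax / (2 * G)))) * M))) := by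
  -- reflected data on `[c, 2c - b]`, split point `2c - e`
  have hmem : ∀ s ∈ Icc c (2 * c - b), 2 * c - s ∈ Icc b c := fun s hs => ⟨by linarith [hs.2], by linarith [hs.1]⟩
  have hrefl : ∀ s : ℝ, HasDerivAt (fun r : ℝ => 2 * c - r) (-1) s := fun s => by
    simpa using (hasDerivAt_id s).const_sub (2 * c)
  have hzr : ∀ s ∈ Icc c (2 * c - b), HasDerivAt (fun r => z (2 * c - r)) (-z' (2 * c - s)) s := by
    intro s hs
    have h := (hz (2 * c - s) (hmem s hs)).scomp s (hrefl s)
    simpa [Function.comp_def] using h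
  have hβr : ∀ s ∈ Icc c (2 * c - b), HasDerivAt (fun r => β (2 * c - r)) (-β' (2 * c - s)) s := by
    intro s hs
    have h := (hβ (2 * c - s) (hmem s hs)).scomp s (hrefl s)
    simpa [Function.comp_def] using h
  have hwr : Continuous fun r => -w (2 * c - r) := (hwcont.comp (continuous_const.sub continuous_id)).neg
  have hwrc : -w (2 * c - c) = 0 := by rw [show 2 * c - c = c by ring, hwc, neg_zero]
  have hwrpos : ∀ s ∈ Ioc c (2 * c - b), 0 < -w (2 * c - s) := by
    intro s hs
    have := hw (2 * c - s) ⟨by linarith [hs.2], by linarith [hs.1]⟩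
    linarith
  have hwr1 : ∀ s ∈ Icc (2 * c - e) (2 * c - b), w₁ * (s - c) ≤ -w (2 * c - s) := by
    intro s hs
    have := hw1 (2 * c - s) ⟨by linarith [hs.2], by linarith [hs.1]⟩
    rw [show c - (2 * c - s) = s - c by ring] at this
    exact this
  have hoder : ∀ s ∈ Icc c (2 * c - b), ((-w (2 * c - s) : ℝ) : ℂ) * (-z' (2 * c - s))
      = I * G * z (2 * c - s) + α (2 * c - s) * z (2 * c - s) + β (2 * c - s) * conj (z (2 * c - s)) + f (2 * c - s) := by
    intro s hs
    rw [← hode (2 * c - s) (hmem s hs)]; push_cast; ring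
  have hfr : ∀ s ∈ Icc c (2 * c - b), ‖f (2 * c - s)‖ ≤ M := fun s hs => hf _ (hmem s hs)
  have hβmaxr : ∀ s ∈ Icc c (2 * c - b), ‖β (2 * c - s)‖ ≤ βmax := fun s hs => hβmax _ (hmem s hs)
  have hgainr : ∀ s ∈ Icc c (2 * c - e), β₀ ≤ -(α (2 * c - s)).re
      - (βmax / (2 * G)) / (1 - βmax / (2 * G)) * (2 * |(α (2 * c - s)).im| + βmax / (2 * G) * ‖β (2 * c - s)‖)
      - (-w (2 * c - s) * ‖-β' (2 * c - s)‖ / (2 * G)) / (1 - βmax / (2 * G)) := by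
    intro s hs
    rw [norm_neg]
    exact hgain (2 * c - s) ⟨by linarith [hs.2], by linarith [hs.1]⟩
  have hstagr : β₀ ≤ G - ‖α (2 * c - c)‖ - ‖β (2 * c - c)‖ := by rw [show 2 * c - c = c by ring]; exact hstag
  have hgrowr : ∀ s ∈ Icc (2 * c - e) (2 * c - b), (α (2 * c - s)).re + β₀
      + (βmax / (2 * G)) / (1 - βmax / (2 * G)) * (2 * |(α (2 * c - s)).im| + βmax / (2 * G) * ‖β (2 * c - s)‖)
      + (-w (2 * c - s) * ‖-β' (2 * c - s)‖ / (2 * G)) / (1 - βmax / (2 * G)) ≤ p * w₁ := by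
    intro s hs
    rw [norm_neg]
    exact hgrow (2 * c - s) ⟨by linarith [hs.2], by linarith [hs.1]⟩
  have h := twoZone_norm_le_var (z := fun r => z (2 * c - r)) (α := fun r => α (2 * c - r)) (β := fun r => β (2 * c - r))
    (β' := fun r => -β' (2 * c - r)) (f := fun r => f (2 * c - r)) (d := 2 * c - e) (b := 2 * c - b)
    hG hM hβ₀ hβmax0 (by linarith) (by linarith) hw₁ hp0 hzr hβr hwr hwrc hwrpos hwr1 hoder hfr hβmaxr hsmall hgainr hstagr hgrowr
  refine ⟨fun τ hτ => ?_, fun τ hτ => ?_⟩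
  · have h1 := h.1 (2 * c - τ) ⟨by linarith [hτ.2], by linarith [hτ.1]⟩
    simpa using h1
  · have h2 := h.2 (2 * c - τ) ⟨by linarith [hτ.2], by linarith [hτ.1]⟩
    have e1 : (2 * c - τ - c) / (2 * c - e - c) = (c - τ) / (c - e) := by
      congr 1 <;> ring
    rw [e1] at h2
    simpa using h2

end Summit.NavierStokesRegularity.NavierStokesRegularity.Theorems.Clause13Transport

end

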